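import Literature.NumberTheory.Rogawski1990.LocalTransferCentralSingularJunctionCM          -- ★ p841395 F0P2-p02 (g8): the S1 junction (its imports carry the whole local currency)
import HarnessLib

/-!
# THE TORUS–SINGULAR JUNCTION AT THE CM CARRIERS, FILE 1: the SIDED sums at a `G`-regular torus point near `ε_H = (A_{a,b}, a)`
# (Rogawski 1990 Prop. 8.2.1 (c); Langlands–Shelstad descent §2.4) — the weighted ε-side re-indexing and the torus-point identity

Topic `NumberTheory/Rogawski1990`; namespace `Literature.NumberTheory.Rogawski1990`.  FILE 1 of 2: TWO THEOREMS + private bookkeeping (no definition, no instance, no notation, no named fact,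
no `sorry`).  Cell `pub/hodgecm-mathlib` (D-0151), crux H413 = stmt-HodgeConjecture-24833, floor-2 line «N6nsGerm» (`Cruxes/H413/Lines/F0_P3a_N6nsGerm.lean`, stub `stub_N6nsS2`),
LEAD F0P3a-plan (g9) WORD T8-78 «(α″) S2 JUNCTION»; seat F0P2-p02 (g8) (pen of the line).  HONEST LABEL: HC_CM is proved only modulo the printed citations until rung 0 closes; this
file proves `stub_N6nsS2` ONLY MODULO ITS BINDERS (torus chart at `ε_H`, torus Haar normalisation, central dock of `H♭ := Z_{G′}(ε)` and torus transport `τ`, SEP′ and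
side-disjointness, SIDED uniform fibre, DESCENT at `ε` (the S1 object, same tokens, at the base point `εf`), SATURATION at `εf`, the rank-one ENDOSCOPIC transfer in
locally-constant-extension dress (R1-lc), and the compact-side vanishing).

THE MATHEMATICS.  `ε_H = (A, a)` with `A ∈ U(Φ₂)_v` regular semisimple (eigenvalues `a ≠ b`) is H-REGULAR (`Z_H(ε_H) = T_H` a maximal torus) but G-SINGULAR: the norm class of
`ι(ε_H)` is the stable class of `ε` (`Z_{G′}(ε) ≅ U(1,1)_v × L¹ =: H♭ ≅ H_v` as groups, docked by `θ : H_v ≃ₜ* Z_{G′}(ε)`, with `ι(T_H)` a maximal torus: `θ (τ t) = y ι(t) y⁻¹`) and of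
`ε′` (compact centraliser).  For `t ∈ T_H` `G`-regular near `ε_H`: `R_φ(t) = Σ_{ε-side} + Σ_{ε′-side}` (SIDED uniform fibre); the `ε′`-side VANISHES identically (compact
`U(2)_an`: equal canonical orbital integrals of the two classes, opposite `κ`); the `ε`-side is re-indexed through the dock and the DESCENT as the WEIGHTED sum
`Σᶠ_d Δ_v(t, θ(out d))·Φ^H(d, φ_ε)` over the `H♭`-classes of the stable class of `τ t` (bijection `d ↦ ⟦θ(out d)⟧`, saturation + SEP′), which (R1-lc) — «`μ⁻¹(γ₁−γ₂)D ×`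
the `κ`-orbital integral of `U(1,1)` near its centre extends smoothly to the torus» — turns into a LOCALLY CONSTANT `g` on a torus box; since `ε_H` is H-regular, `g` IS a local
stable orbital integral (★ pointwise realisation `…_of_chart_of_mem` over the torus chart at `ε_H`), and conjugation invariance (★ `hl`, ★ `stableOrbitalIntegralRel_congr_of_rel`)
leaves the torus.  [Rogawski1990 §8.2 Prop. 8.2.1 (c) pp. 113–115, §4.9 Lemma 4.9.3 p. 56; LanglandsShelstad1990Descent §2.4; LabesseLanglands1979 §2.]

## References
* [Rogawski1990] J. Rogawski, *Automorphic Representations of Unitary Groups in Three Variables*, Ann. of Math. Stud. 123 (1990): §8.2 Prop. 8.2.1 (c) pp. 113–115; §4.9 Lemma 4.9.3 p. 56; §4.3 (4.3.1) p. 43.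
* [LanglandsShelstad1990Descent] R. P. Langlands, D. Shelstad, *Descent for transfer factors* (1990): §2.4.
* [LabesseLanglands1979] J.-P. Labesse, R. P. Langlands, *L-indistinguishability for SL(2)*, Canad. J. Math. 31 (1979): §2 (the rank-one input (R1), a binder here).
-/

set_option autoImplicit false

noncomputable section

open Set Filter Topology MeasureTheory Polynomial
open scoped Pointwise Matrix

namespace Literature.NumberTheory.Rogawski1990

open Literature.NumberTheory.Automorphic Literature.NumberTheory.Automorphic.UnitaryGroup Literature.NumberTheory.GaloisRepresentations
open _root_.NumberField _root_.IsDedekindDomain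

section TorusSingular

variable (L : Type) [Field L] [NumberField L] [IsCMField L] (H' : Matrix (Fin 3) (Fin 3) L) (v : HeightOneSpectrum (𝓞 ↥(maximalRealSubfield L)))

/-! ## §1 Bookkeeping (instance-path-stable, over a `Group`) -/

/-- `⟦out c⟧ = c`. [folklore] -/
private theorem conjClasses_mk_quotient_out₂ {G : Type*} [Monoid G] (c : ConjClasses G) : ConjClasses.mk (Quotient.out c) = c := by
  rw [← ConjClasses.quotient_mk_eq_mk, Quotient.out_eq]

/-- `⟦x·g·x⁻¹⟧ = ⟦g⟧`. [folklore] -/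
private theorem conjClasses_mk_conj_eq₂ {G : Type*} [Group G] (x g : G) : ConjClasses.mk (x * g * x⁻¹) = ConjClasses.mk g :=
  (ConjClasses.mk_eq_mk_iff_isConj.2 (isConj_iff.2 ⟨x, rfl⟩)).symm

/-- A representative of `⟦g⟧` is conjugate to `g`. [folklore] -/
private theorem isConj_quotient_out_conjClassesMk₂ {G : Type*} [Group G] (g : G) : IsConj g (Quotient.out (ConjClasses.mk g)) :=
  ConjClasses.mk_eq_mk_iff_isConj.1 (conjClasses_mk_quotient_out₂ (ConjClasses.mk g)).symm

/-- A class-respecting relation passes to the chosen representative (conjugation-form hypothesis). [folklore] -/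
private theorem rel_quotient_out_conjClassesMk₂ {G : Type*} [Group G] {st : G → G → Prop}
    (hconj : ∀ a x : G, st a (x * a * x⁻¹)) (htrans : ∀ a b c : G, st a b → st b c → st a c)
    {γ a : G} (h : st γ a) : st γ (Quotient.out (ConjClasses.mk a)) := by
  obtain ⟨c, hc⟩ := isConj_iff.1 (isConj_quotient_out_conjClassesMk₂ a)
  rw [← hc]
  exact htrans _ _ _ h (hconj a c)

/-- Splitting a finitely supported sum along two disjoint predicates covering the support. [folklore] -/
private theorem finsum_eq_finsum_mem_add_finsum_mem {ι : Type*} (F : ι → ℂ) (hF : (Function.support F).Finite) (P Q : ι → Prop)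
    (hcover : ∀ c, F c ≠ 0 → P c ∨ Q c) (hdisj : ∀ c, P c → Q c → False) :
    ∑ᶠ c, F c = (∑ᶠ c ∈ {c | P c}, F c) + ∑ᶠ c ∈ {c | Q c}, F c := by
  classical
  have hsplit : ∀ c, F c = (if P c then F c else 0) + (if Q c then F c else 0) := by
    intro c
    by_cases h0 : F c = 0
    · simp only [h0, ite_self, add_zero]
    · rcases hcover c h0 with hP | hQ
      · rw [if_pos hP, if_neg (fun hQ => hdisj c hP hQ), add_zero]
      · rw [if_neg (fun hP => hdisj c hP hQ), if_pos hQ, zero_add]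
  have hfin₁ : (Function.support fun c => if P c then F c else 0).Finite :=
    hF.subset fun c hc => by
      simp only [Function.mem_support, ne_eq, ite_eq_right_iff, Classical.not_imp] at hc ⊢
      exact hc.2
  have hfin₂ : (Function.support fun c => if Q c then F c else 0).Finite :=
    hF.subset fun c hc => by
      simp only [Function.mem_support, ne_eq, ite_eq_right_iff, Classical.not_imp] at hc ⊢
      exact hc.2
  have hite : ∀ R : ι → Prop, (∑ᶠ c, if R c then F c else 0) = ∑ᶠ c ∈ {c | R c}, F c := by
    intro R
    rw [finsum_mem_def]
    exact finsum_congr fun c => (Set.indicator_apply _ _ _).symm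
  rw [← hite, ← hite, ← finsum_add_distrib hfin₁ hfin₂]
  exact finsum_congr hsplit

/-! ## §2 The weighted ε-side re-indexing -/

variable [iM' : ∀ γ : (cmDatum L 3 H').Local v, MeasurableSpace ((cmDatum L 3 H').Local v ⧸ Subgroup.centralizer ({γ} : Set ((cmDatum L 3 H').Local v)))]
  [iH : ∀ a : ((cmDatum L 2 (Matrix.of fun i j : Fin 2 => if i.val + j.val + 1 = 2 then (1 : L) else 0)).Local v ×
      (cmDatum L 1 (Matrix.of fun i j : Fin 1 => if i.val + j.val + 1 = 1 then (1 : L) else 0)).Local v), MeasurableSpace (((cmDatum L 2 (Matrix.of fun i j : Fin 2 => if i.val + j.val + 1 = 2 then (1 : L) else 0)).Local v ×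
      (cmDatum L 1 (Matrix.of fun i j : Fin 1 => if i.val + j.val + 1 = 1 then (1 : L) else 0)).Local v) ⧸ Subgroup.centralizer ({a} : Set ((cmDatum L 2 (Matrix.of fun i j : Fin 2 => if i.val + j.val + 1 = 2 then (1 : L) else 0)).Local v ×
      (cmDatum L 1 (Matrix.of fun i j : Fin 1 => if i.val + j.val + 1 = 1 then (1 : L) else 0)).Local v)))]

set_option maxHeartbeats 400000 in
/-- **THE WEIGHTED ε-SIDE SUM** (LS-Descent §2.4 bookkeeping at the good class, `Δ‴` NOT assumed constant).  For `a, γ ∈ H_v` (`a` = the `Δ`-argument, `γ` = the element whose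
`H♭`-stable class is summed over), a box `B ⊆ H_v` with (i) saturation of the stable class of `γ` into `B`, (ii) SEP′ for `θ`-images of box points, (iii) descent at the box points
stably conjugate to `γ`: the part of `Σ_c Δ_v(a, c)·Φ(c, φ)` over the classes conjugate into `θ(B)` at a point stably conjugate to `γ` equals the WEIGHTED sum
`Σᶠ_{d : st γ (out d)} Δ_v(a, θ(out d))·Φ(d, φ_ε; m_H)` (bijection `d ↦ ⟦θ(out d)⟧`, ★ `hr` conjugation invariance of `Δ_v`). [cite: Rogawski1990, §8.2 Prop. 8.2.1 (c) p. 113; §4.3 (4.3.1) p. 43]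
[cite: LanglandsShelstad1990Descent, §2.4] -/
theorem finsum_mem_side_eq_finsum_weighted (μ : HeckeCharacter L)
    (hl : ∀ (v : HeightOneSpectrum (𝓞 ↥(maximalRealSubfield L))) (a : ((cmDatum L 2 (Matrix.of fun i j : Fin 2 => if i.val + j.val + 1 = 2 then (1 : L) else 0)).Local v ×
      (cmDatum L 1 (Matrix.of fun i j : Fin 1 => if i.val + j.val + 1 = 1 then (1 : L) else 0)).Local v)) (b : (cmDatum L 3 H').Local v) (x : ((cmDatum L 2 (Matrix.of fun i j : Fin 2 => if i.val + j.val + 1 = 2 then (1 : L) else 0)).Local v ×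
      (cmDatum L 1 (Matrix.of fun i j : Fin 1 => if i.val + j.val + 1 = 1 then (1 : L) else 0)).Local v)),
      finExplicitDelta L v H' (x * a * x⁻¹) μ b = finExplicitDelta L v H' a μ b)
    (hr : ∀ (v : HeightOneSpectrum (𝓞 ↥(maximalRealSubfield L))) (a : ((cmDatum L 2 (Matrix.of fun i j : Fin 2 => if i.val + j.val + 1 = 2 then (1 : L) else 0)).Local v ×
      (cmDatum L 1 (Matrix.of fun i j : Fin 1 => if i.val + j.val + 1 = 1 then (1 : L) else 0)).Local v)) (b y : (cmDatum L 3 H').Local v),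
      finExplicitDelta L v H' a μ (y * b * y⁻¹) = finExplicitDelta L v H' a μ b)
    (mH : OrbitalMeasureFamily ((cmDatum L 2 (Matrix.of fun i j : Fin 2 => if i.val + j.val + 1 = 2 then (1 : L) else 0)).Local v ×
      (cmDatum L 1 (Matrix.of fun i j : Fin 1 => if i.val + j.val + 1 = 1 then (1 : L) else 0)).Local v)) (mG : OrbitalMeasureFamily ((cmDatum L 3 H').Local v))
    {ε : (cmDatum L 3 H').Local v} (θ : ((cmDatum L 2 (Matrix.of fun i j : Fin 2 => if i.val + j.val + 1 = 2 then (1 : L) else 0)).Local v ×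
      (cmDatum L 1 (Matrix.of fun i j : Fin 1 => if i.val + j.val + 1 = 1 then (1 : L) else 0)).Local v) ≃ₜ* ↥(Subgroup.centralizer ({ε} : Set ((cmDatum L 3 H').Local v)))) (a γ : ((cmDatum L 2 (Matrix.of fun i j : Fin 2 => if i.val + j.val + 1 = 2 then (1 : L) else 0)).Local v ×
      (cmDatum L 1 (Matrix.of fun i j : Fin 1 => if i.val + j.val + 1 = 1 then (1 : L) else 0)).Local v)) (B : Set ((cmDatum L 2 (Matrix.of fun i j : Fin 2 => if i.val + j.val + 1 = 2 then (1 : L) else 0)).Local v ×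
      (cmDatum L 1 (Matrix.of fun i j : Fin 1 => if i.val + j.val + 1 = 1 then (1 : L) else 0)).Local v))
    (φ : (cmDatum L 3 H').Local v → ℂ) (φε : ((cmDatum L 2 (Matrix.of fun i j : Fin 2 => if i.val + j.val + 1 = 2 then (1 : L) else 0)).Local v ×
      (cmDatum L 1 (Matrix.of fun i j : Fin 1 => if i.val + j.val + 1 = 1 then (1 : L) else 0)).Local v) → ℂ)
    (hsatB : ∀ h' : ((cmDatum L 2 (Matrix.of fun i j : Fin 2 => if i.val + j.val + 1 = 2 then (1 : L) else 0)).Local v ×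
      (cmDatum L 1 (Matrix.of fun i j : Fin 1 => if i.val + j.val + 1 = 1 then (1 : L) else 0)).Local v), IsLocalStablyConjH L v γ h' → ∃ x : ((cmDatum L 2 (Matrix.of fun i j : Fin 2 => if i.val + j.val + 1 = 2 then (1 : L) else 0)).Local v ×
      (cmDatum L 1 (Matrix.of fun i j : Fin 1 => if i.val + j.val + 1 = 1 then (1 : L) else 0)).Local v), x * h' * x⁻¹ ∈ B)
    (hsepB : ∀ h ∈ B, ∀ h' ∈ B, ∀ x : (cmDatum L 3 H').Local v, x * ((θ h : ↥(Subgroup.centralizer ({ε} : Set ((cmDatum L 3 H').Local v)))) : (cmDatum L 3 H').Local v) * x⁻¹ = ((θ h' : ↥(Subgroup.centralizer ({ε} : Set ((cmDatum L 3 H').Local v)))) : (cmDatum L 3 H').Local v) → IsConj h h')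
    (hdescB : ∀ h ∈ B, IsLocalStablyConjH L v γ h →
      classOrbitalIntegral mG φ (ConjClasses.mk ((θ h : ↥(Subgroup.centralizer ({ε} : Set ((cmDatum L 3 H').Local v)))) : (cmDatum L 3 H').Local v)) = classOrbitalIntegral mH φε (ConjClasses.mk h)) :
    (∑ᶠ c ∈ {c : ConjClasses ((cmDatum L 3 H').Local v) | ∃ x : (cmDatum L 3 H').Local v, ∃ h ∈ B, IsLocalStablyConjH L v γ h ∧ x * Quotient.out c * x⁻¹ = ((θ h : ↥(Subgroup.centralizer ({ε} : Set ((cmDatum L 3 H').Local v)))) : (cmDatum L 3 H').Local v)},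
        ((finExplicitCollection L H' μ hl hr) v).Δ a (Quotient.out c) * classOrbitalIntegral mG φ c) =
      ∑ᶠ d ∈ {d : ConjClasses ((cmDatum L 2 (Matrix.of fun i j : Fin 2 => if i.val + j.val + 1 = 2 then (1 : L) else 0)).Local v ×
      (cmDatum L 1 (Matrix.of fun i j : Fin 1 => if i.val + j.val + 1 = 1 then (1 : L) else 0)).Local v) | IsLocalStablyConjH L v γ (Quotient.out d)},
        ((finExplicitCollection L H' μ hl hr) v).Δ a ((θ (Quotient.out d) : ↥(Subgroup.centralizer ({ε} : Set ((cmDatum L 3 H').Local v)))) : (cmDatum L 3 H').Local v) * classOrbitalIntegral mH φε d := by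
  classical
  have hθconj : ∀ z h : ((cmDatum L 2 (Matrix.of fun i j : Fin 2 => if i.val + j.val + 1 = 2 then (1 : L) else 0)).Local v ×
      (cmDatum L 1 (Matrix.of fun i j : Fin 1 => if i.val + j.val + 1 = 1 then (1 : L) else 0)).Local v), ((θ (z * h * z⁻¹) : ↥(Subgroup.centralizer ({ε} : Set ((cmDatum L 3 H').Local v)))) : (cmDatum L 3 H').Local v) =
      ((θ z : ↥(Subgroup.centralizer ({ε} : Set ((cmDatum L 3 H').Local v)))) : (cmDatum L 3 H').Local v) * ((θ h : ↥(Subgroup.centralizer ({ε} : Set ((cmDatum L 3 H').Local v)))) : (cmDatum L 3 H').Local v) * ((θ z : ↥(Subgroup.centralizer ({ε} : Set ((cmDatum L 3 H').Local v)))) : (cmDatum L 3 H').Local v)⁻¹ := by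
    intro z h
    rw [map_mul, map_mul, map_inv, Subgroup.coe_mul, Subgroup.coe_mul, Subgroup.coe_inv]
  have key : ∀ d ∈ {d : ConjClasses ((cmDatum L 2 (Matrix.of fun i j : Fin 2 => if i.val + j.val + 1 = 2 then (1 : L) else 0)).Local v ×
      (cmDatum L 1 (Matrix.of fun i j : Fin 1 => if i.val + j.val + 1 = 1 then (1 : L) else 0)).Local v) | IsLocalStablyConjH L v γ (Quotient.out d)},
      ∃ h ∈ B, IsLocalStablyConjH L v γ h ∧ ConjClasses.mk h = d ∧
        ConjClasses.mk ((θ h : ↥(Subgroup.centralizer ({ε} : Set ((cmDatum L 3 H').Local v)))) : (cmDatum L 3 H').Local v) = ConjClasses.mk ((θ (Quotient.out d) : ↥(Subgroup.centralizer ({ε} : Set ((cmDatum L 3 H').Local v)))) : (cmDatum L 3 H').Local v) := by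
    intro d hd
    obtain ⟨z, hzB⟩ := hsatB _ hd
    refine ⟨z * Quotient.out d * z⁻¹, hzB, IsStablyConjH.trans hd (isStablyConjH_of_isConj (isConj_iff.2 ⟨z, rfl⟩)), ?_, ?_⟩
    · rw [conjClasses_mk_conj_eq₂, conjClasses_mk_quotient_out₂]
    · rw [hθconj, conjClasses_mk_conj_eq₂]
  have hPεθ : ∀ h ∈ B, IsLocalStablyConjH L v γ h →
      ∃ x : (cmDatum L 3 H').Local v, ∃ h' ∈ B, IsLocalStablyConjH L v γ h' ∧
        x * Quotient.out (ConjClasses.mk ((θ h : ↥(Subgroup.centralizer ({ε} : Set ((cmDatum L 3 H').Local v)))) : (cmDatum L 3 H').Local v)) * x⁻¹ = ((θ h' : ↥(Subgroup.centralizer ({ε} : Set ((cmDatum L 3 H').Local v)))) : (cmDatum L 3 H').Local v) := by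
    intro h hhB hst
    obtain ⟨x, hx⟩ := isConj_iff.1 (isConj_quotient_out_conjClassesMk₂ ((θ h : ↥(Subgroup.centralizer ({ε} : Set ((cmDatum L 3 H').Local v)))) : (cmDatum L 3 H').Local v)).symm
    exact ⟨x, h, hhB, hst, hx⟩
  symm
  refine finsum_mem_eq_of_bijOn (fun d : ConjClasses ((cmDatum L 2 (Matrix.of fun i j : Fin 2 => if i.val + j.val + 1 = 2 then (1 : L) else 0)).Local v ×
      (cmDatum L 1 (Matrix.of fun i j : Fin 1 => if i.val + j.val + 1 = 1 then (1 : L) else 0)).Local v) => ConjClasses.mk ((θ (Quotient.out d) : ↥(Subgroup.centralizer ({ε} : Set ((cmDatum L 3 H').Local v)))) : (cmDatum L 3 H').Local v)) ⟨?_, ?_, ?_⟩ ?_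
  · intro d hd
    obtain ⟨h, hhB, hst, -, hθh⟩ := key d hd
    simp only [Set.mem_setOf_eq]
    rw [← hθh]
    exact hPεθ h hhB hst
  · intro d₁ hd₁ d₂ hd₂ h12
    obtain ⟨h₁, hh₁B, -, hh₁d, hθh₁⟩ := key d₁ hd₁
    obtain ⟨h₂, hh₂B, -, hh₂d, hθh₂⟩ := key d₂ hd₂
    have h12' : ConjClasses.mk ((θ h₁ : ↥(Subgroup.centralizer ({ε} : Set ((cmDatum L 3 H').Local v)))) : (cmDatum L 3 H').Local v) = ConjClasses.mk ((θ h₂ : ↥(Subgroup.centralizer ({ε} : Set ((cmDatum L 3 H').Local v)))) : (cmDatum L 3 H').Local v) := by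
      rw [hθh₁, hθh₂]; exact h12
    obtain ⟨x, hx⟩ := isConj_iff.1 (ConjClasses.mk_eq_mk_iff_isConj.1 h12')
    rw [← hh₁d, ← hh₂d]
    exact ConjClasses.mk_eq_mk_iff_isConj.2 (hsepB h₁ hh₁B h₂ hh₂B x hx)
  · intro c hc
    obtain ⟨x, h, hhB, hst, hx⟩ := hc
    obtain ⟨z, hz⟩ := isConj_iff.1 (isConj_quotient_out_conjClassesMk₂ h)
    refine ⟨ConjClasses.mk h, ?_, ?_⟩
    · simp only [Set.mem_setOf_eq]
      exact rel_quotient_out_conjClassesMk₂ (st := IsLocalStablyConjH L v) (fun a x => isStablyConjH_of_isConj (isConj_iff.2 ⟨x, rfl⟩))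
        (fun _ _ _ h₁ h₂ => IsStablyConjH.trans h₁ h₂) hst
    · beta_reduce
      rw [← hz, hθconj, conjClasses_mk_conj_eq₂, ← hx, conjClasses_mk_conj_eq₂, conjClasses_mk_quotient_out₂]
  · intro d hd
    obtain ⟨h, hhB, hst, hhd, hθh⟩ := key d hd
    obtain ⟨x, hx⟩ := isConj_iff.1 (isConj_quotient_out_conjClassesMk₂ ((θ (Quotient.out d) : ↥(Subgroup.centralizer ({ε} : Set ((cmDatum L 3 H').Local v)))) : (cmDatum L 3 H').Local v)).symm
    have h1 : ((finExplicitCollection L H' μ hl hr) v).Δ a (Quotient.out (ConjClasses.mk ((θ (Quotient.out d) : ↥(Subgroup.centralizer ({ε} : Set ((cmDatum L 3 H').Local v)))) : (cmDatum L 3 H').Local v))) =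
        ((finExplicitCollection L H' μ hl hr) v).Δ a ((θ (Quotient.out d) : ↥(Subgroup.centralizer ({ε} : Set ((cmDatum L 3 H').Local v)))) : (cmDatum L 3 H').Local v) := by
      rw [finExplicitCollection_Δ, finExplicitCollection_Δ, ← hr v a _ x, hx]
    have h2 : classOrbitalIntegral mG φ (ConjClasses.mk ((θ (Quotient.out d) : ↥(Subgroup.centralizer ({ε} : Set ((cmDatum L 3 H').Local v)))) : (cmDatum L 3 H').Local v)) = classOrbitalIntegral mH φε d := by
      rw [← hθh, hdescB h hhB hst, hhd]
    rw [h1, h2]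

/-! ## §3 The torus-point identity -/

/-- **THE TORUS-POINT IDENTITY** (Prop. 8.2.1 (c), pointwise bookkeeping).  At a `G`-regular `a ∈ H_v` with base element `γ` (`= τ t`, `G`-regular) and boxes `B ∋ ε♭` (good
side, in `H♭ = H_v` through `θ`) and `B′` (bad side, in `Z_{G′}(ε′)`): if every class matched with `a` is conjugate into `θ(B)` at a point stably conjugate to `γ` or into `B′`
(`hside`), the two sides share no class (`hdj`), the ε-side data (saturation, SEP′, descent) hold on `B`, the weighted ε-side sum has the value `gval` (`hval`, the (R1-lc)
binder read at `t`) and the ε′-side vanishes (`hzero`), then `Σᶠ_c Δ_v(a, c)·Φ(c, φ) = gval`. [cite: Rogawski1990, §8.2 Prop. 8.2.1 (c) pp. 113–115; §4.3 (4.3.1) p. 43]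
[cite: LanglandsShelstad1990Descent, §2.4] -/
theorem finsum_delta_mul_classOrbitalIntegral_eq_of_sides (hH' : (H'.map (cmConjRingHom L))ᵀ = H') (hdet' : H'.det ≠ 0) (μ : HeckeCharacter L)
    (hl : ∀ (v : HeightOneSpectrum (𝓞 ↥(maximalRealSubfield L))) (a : ((cmDatum L 2 (Matrix.of fun i j : Fin 2 => if i.val + j.val + 1 = 2 then (1 : L) else 0)).Local v ×
      (cmDatum L 1 (Matrix.of fun i j : Fin 1 => if i.val + j.val + 1 = 1 then (1 : L) else 0)).Local v)) (b : (cmDatum L 3 H').Local v) (x : ((cmDatum L 2 (Matrix.of fun i j : Fin 2 => if i.val + j.val + 1 = 2 then (1 : L) else 0)).Local v ×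
      (cmDatum L 1 (Matrix.of fun i j : Fin 1 => if i.val + j.val + 1 = 1 then (1 : L) else 0)).Local v)),
      finExplicitDelta L v H' (x * a * x⁻¹) μ b = finExplicitDelta L v H' a μ b)
    (hr : ∀ (v : HeightOneSpectrum (𝓞 ↥(maximalRealSubfield L))) (a : ((cmDatum L 2 (Matrix.of fun i j : Fin 2 => if i.val + j.val + 1 = 2 then (1 : L) else 0)).Local v ×
      (cmDatum L 1 (Matrix.of fun i j : Fin 1 => if i.val + j.val + 1 = 1 then (1 : L) else 0)).Local v)) (b y : (cmDatum L 3 H').Local v),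
      finExplicitDelta L v H' a μ (y * b * y⁻¹) = finExplicitDelta L v H' a μ b)
    (mH : OrbitalMeasureFamily ((cmDatum L 2 (Matrix.of fun i j : Fin 2 => if i.val + j.val + 1 = 2 then (1 : L) else 0)).Local v ×
      (cmDatum L 1 (Matrix.of fun i j : Fin 1 => if i.val + j.val + 1 = 1 then (1 : L) else 0)).Local v)) (mG : OrbitalMeasureFamily ((cmDatum L 3 H').Local v))
    {ε : (cmDatum L 3 H').Local v} (θ : ((cmDatum L 2 (Matrix.of fun i j : Fin 2 => if i.val + j.val + 1 = 2 then (1 : L) else 0)).Local v ×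
      (cmDatum L 1 (Matrix.of fun i j : Fin 1 => if i.val + j.val + 1 = 1 then (1 : L) else 0)).Local v) ≃ₜ* ↥(Subgroup.centralizer ({ε} : Set ((cmDatum L 3 H').Local v)))) {ε' : (cmDatum L 3 H').Local v} (a γ : ((cmDatum L 2 (Matrix.of fun i j : Fin 2 => if i.val + j.val + 1 = 2 then (1 : L) else 0)).Local v ×
      (cmDatum L 1 (Matrix.of fun i j : Fin 1 => if i.val + j.val + 1 = 1 then (1 : L) else 0)).Local v)) (B : Set ((cmDatum L 2 (Matrix.of fun i j : Fin 2 => if i.val + j.val + 1 = 2 then (1 : L) else 0)).Local v ×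
      (cmDatum L 1 (Matrix.of fun i j : Fin 1 => if i.val + j.val + 1 = 1 then (1 : L) else 0)).Local v)) (B' : Set ↥(Subgroup.centralizer ({ε'} : Set ((cmDatum L 3 H').Local v))))
    (φ : (cmDatum L 3 H').Local v → ℂ) (φε : ((cmDatum L 2 (Matrix.of fun i j : Fin 2 => if i.val + j.val + 1 = 2 then (1 : L) else 0)).Local v ×
      (cmDatum L 1 (Matrix.of fun i j : Fin 1 => if i.val + j.val + 1 = 1 then (1 : L) else 0)).Local v) → ℂ) (gval : ℂ) (ha : IsLocalGRegular L v a) (hγ : IsLocalGRegular L v γ) (hφ : IsLocSmooth φ)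
    (hside : ∀ γ' : (cmDatum L 3 H').Local v, IsLocalNormPair L H' v a γ' →
      (∃ x : (cmDatum L 3 H').Local v, ∃ h ∈ B, IsLocalStablyConjH L v γ h ∧ x * γ' * x⁻¹ = ((θ h : ↥(Subgroup.centralizer ({ε} : Set ((cmDatum L 3 H').Local v)))) : (cmDatum L 3 H').Local v)) ∨
      (∃ x : (cmDatum L 3 H').Local v, ∃ m' ∈ B', x * γ' * x⁻¹ = (m' : (cmDatum L 3 H').Local v)))
    (hdj : ∀ h ∈ B, ∀ m' ∈ B', ∀ x : (cmDatum L 3 H').Local v, x * ((θ h : ↥(Subgroup.centralizer ({ε} : Set ((cmDatum L 3 H').Local v)))) : (cmDatum L 3 H').Local v) * x⁻¹ ≠ (m' : (cmDatum L 3 H').Local v))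
    (hsatB : ∀ h' : ((cmDatum L 2 (Matrix.of fun i j : Fin 2 => if i.val + j.val + 1 = 2 then (1 : L) else 0)).Local v ×
      (cmDatum L 1 (Matrix.of fun i j : Fin 1 => if i.val + j.val + 1 = 1 then (1 : L) else 0)).Local v), IsLocalStablyConjH L v γ h' → ∃ x : ((cmDatum L 2 (Matrix.of fun i j : Fin 2 => if i.val + j.val + 1 = 2 then (1 : L) else 0)).Local v ×
      (cmDatum L 1 (Matrix.of fun i j : Fin 1 => if i.val + j.val + 1 = 1 then (1 : L) else 0)).Local v), x * h' * x⁻¹ ∈ B)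
    (hsepB : ∀ h ∈ B, ∀ h' ∈ B, ∀ x : (cmDatum L 3 H').Local v, x * ((θ h : ↥(Subgroup.centralizer ({ε} : Set ((cmDatum L 3 H').Local v)))) : (cmDatum L 3 H').Local v) * x⁻¹ = ((θ h' : ↥(Subgroup.centralizer ({ε} : Set ((cmDatum L 3 H').Local v)))) : (cmDatum L 3 H').Local v) → IsConj h h')
    (hdescB : ∀ h ∈ B, IsLocalGRegular L v h →
      classOrbitalIntegral mG φ (ConjClasses.mk ((θ h : ↥(Subgroup.centralizer ({ε} : Set ((cmDatum L 3 H').Local v)))) : (cmDatum L 3 H').Local v)) = classOrbitalIntegral mH φε (ConjClasses.mk h))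
    (hval : (∑ᶠ d ∈ {d : ConjClasses ((cmDatum L 2 (Matrix.of fun i j : Fin 2 => if i.val + j.val + 1 = 2 then (1 : L) else 0)).Local v ×
      (cmDatum L 1 (Matrix.of fun i j : Fin 1 => if i.val + j.val + 1 = 1 then (1 : L) else 0)).Local v) | IsLocalStablyConjH L v γ (Quotient.out d)},
        ((finExplicitCollection L H' μ hl hr) v).Δ a ((θ (Quotient.out d) : ↥(Subgroup.centralizer ({ε} : Set ((cmDatum L 3 H').Local v)))) : (cmDatum L 3 H').Local v) * classOrbitalIntegral mH φε d) = gval)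
    (hzero : (∑ᶠ c ∈ {c : ConjClasses ((cmDatum L 3 H').Local v) | ∃ x : (cmDatum L 3 H').Local v, ∃ m' ∈ B', x * Quotient.out c * x⁻¹ = (m' : (cmDatum L 3 H').Local v)},
        ((finExplicitCollection L H' μ hl hr) v).Δ a (Quotient.out c) * classOrbitalIntegral mG φ c) = 0) :
    (∑ᶠ c : ConjClasses ((cmDatum L 3 H').Local v), ((finExplicitCollection L H' μ hl hr) v).Δ a (Quotient.out c) * classOrbitalIntegral mG φ c) = gval := by
  classical
  have hΔT : ∀ (a' : ((cmDatum L 2 (Matrix.of fun i j : Fin 2 => if i.val + j.val + 1 = 2 then (1 : L) else 0)).Local v ×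
      (cmDatum L 1 (Matrix.of fun i j : Fin 1 => if i.val + j.val + 1 = 1 then (1 : L) else 0)).Local v)) (b : (cmDatum L 3 H').Local v), ((finExplicitCollection L H' μ hl hr) v).Δ a' b = finExplicitDelta L v H' a' μ b :=
    fun a' b => finExplicitCollection_Δ L H' μ hl hr v a' b
  have hregB : ∀ h : ((cmDatum L 2 (Matrix.of fun i j : Fin 2 => if i.val + j.val + 1 = 2 then (1 : L) else 0)).Local v ×
      (cmDatum L 1 (Matrix.of fun i j : Fin 1 => if i.val + j.val + 1 = 1 then (1 : L) else 0)).Local v), IsLocalStablyConjH L v γ h → IsLocalGRegular L v h :=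
    fun h hst => isGRegular_of_isStablyConjH _ _ _ _ hst hγ
  have hFfin : (Function.support fun c : ConjClasses ((cmDatum L 3 H').Local v) =>
      ((finExplicitCollection L H' μ hl hr) v).Δ a (Quotient.out c) * classOrbitalIntegral mG φ c).Finite :=
    finite_support_delta_mul_classOrbitalIntegral_of_isLocSmooth L H' v hH' hdet' _ mG φ hφ a ha
  rw [finsum_eq_finsum_mem_add_finsum_mem _ hFfin
    (fun c => ∃ x : (cmDatum L 3 H').Local v, ∃ h ∈ B, IsLocalStablyConjH L v γ h ∧ x * Quotient.out c * x⁻¹ = ((θ h : ↥(Subgroup.centralizer ({ε} : Set ((cmDatum L 3 H').Local v)))) : (cmDatum L 3 H').Local v))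
    (fun c => ∃ x : (cmDatum L 3 H').Local v, ∃ m' ∈ B', x * Quotient.out c * x⁻¹ = (m' : (cmDatum L 3 H').Local v)) (fun c hc => ?_) (fun c hP hQ => ?_)]
  · rw [hzero, add_zero, ← hval]
    exact finsum_mem_side_eq_finsum_weighted L H' v μ hl hr mH mG θ a γ B φ φε hsatB hsepB
      (fun h hhB hst => hdescB h hhB (hregB h hst))
  · -- a class with a non-zero term is matched, hence on one side
    have hR : IsLocalNormPair L H' v a (Quotient.out c) := by
      by_contra hR
      apply hc
      simp only [hΔT, finExplicitDelta_of_not_isLocalNormPair L v H' a μ hR, zero_mul]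
    exact hside _ hR
  · -- the two sides share no class
    obtain ⟨x, h, hhB, -, hx⟩ := hP
    obtain ⟨x', m', hm', hx'⟩ := hQ
    refine hdj h hhB m' hm' (x' * x⁻¹) ?_
    rw [← hx, ← hx']; group

end TorusSingular

end Literature.NumberTheory.Rogawski1990

end
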